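import Literature.Probability.RandomPlanarGeometry.StopAtThickening
import HarnessLib

/-!
# Stopping twice, and stopped laws along shrinking stopping sets

Topic `Probability/RandomPlanarGeometry`; theorems only. Two technical steps of the transposition
of the locality theorem of chordal SLE₆ (G. F. Lawler, O. Schramm, W. Werner, Acta Math. **187**
(2001), Thm. 2.2, Cor. 2.3–2.4; the tree's `IsSLELaw.locality_six`) to the stopped-curve-class
form `μ (CurveClass.stopAt F ⁻¹' T)`, complementing `StopAtThickening.lean`:

* `Curve.stopAt_stopAt_eq_stopAt`, `CurveClass.stopAt_stopAt_eq_stopAt` — **stopping at a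
  closed set `A` and then at a closed superset `S ⊇ A` is stopping at `S`** (the curve meets
  `S` no later than `A`, so the initial segment up to `A` contains the initial segment up to
  `S`); hence (`measure_preimage_stopAt_eq_of_subset`) two measures with the same `A`-stopped
  law have the same `S`-stopped law — the identities of locality (stop on `closure (D ∖ D')`)
  and of target independence (stop on a boundary arc) transfer to any larger closed stopping
  set;
* `Curve.tendsto_hitParam_of_shrinking`, `CurveClass.tendsto_stopAt_of_shrinking`,
  `measure_preimage_stopAt_eq_of_shrinking` — the limit lemma of `StopAtThickening.lean` for a
  general sequence of closed stopping sets `S n ⊇ F` **shrinking to `F`** in the sense of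
  Kuratowski (every limit of points `z k ∈ S (φ k)`, `φ k → ∞`, lies in `F`; no monotonicity):
  `hitParam (S n) γ → hitParam F γ`, `stopAt (S n) c → stopAt F c` for every class, and two
  finite measures whose `S n`-stopped laws agree for all `n` have the same `F`-stopped law.

## References

* G. F. Lawler, O. Schramm, W. Werner, Acta Math. 187 (2001), §2. [LawlerSchrammWerner2001]
* M. Aizenman, A. Burchard, Duke Math. J. 99 (1999), §2.1 (the curve space). [AizenmanBurchard1999]
-/

noncomputable section

open Set Filter Metric MeasureTheory
open _root_.Topology
open scoped unitInterval ENNReal NNReal BoundedContinuousFunction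

namespace Literature.Probability.RandomPlanarGeometry

namespace Curve

/-! ### Stopping at `A` and then at `S ⊇ A` -/

section Topological

variable {E : Type*} [TopologicalSpace E]

/-- If the curve starts on the closed set `A` (hitting parameter `0`), its initial segment up to
`A` is the constant curve at its starting point. [folklore] -/
theorem stopAt_apply_of_hitParam_eq_zero {A : Set E} {γ : Curve E} (h : γ.hitParam A = 0)
    (s : I) : γ.stopAt A s = γ 0 := by
  rw [stopAt_apply, h, zero_mul, projIcc_left]
  rfl

/-- If the hitting parameter of a closed set is `0`, the curve starts on it. [folklore] -/
theorem apply_zero_mem_of_hitParam_eq_zero {A : Set E} (hA : IsClosed A) {γ : Curve E}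
    (h : γ.hitParam A = 0) : γ 0 ∈ A := by
  rcases hitParam_mem_hitSet hA γ with ⟨hI, hmem⟩ | h1
  · have : (⟨γ.hitParam A, hI⟩ : I) = 0 := Subtype.ext h
    rwa [this] at hmem
  · rw [mem_singleton_iff, h] at h1
    exact absurd h1 zero_ne_one

/-- **The hitting parameter of `S ⊇ A` by the initial segment up to `A`** is
`hitParam S γ / hitParam A γ` (when the latter is positive and `S` is met): the initial segment
is `s ↦ γ (T_A s)`. [folklore] -/
theorem hitParam_stopAt_of_subset {A S : Set E} (hS : IsClosed S) (hAS : A ⊆ S) {γ : Curve E}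
    (hpos : 0 < γ.hitParam A) (hmeet : ∃ t, γ t ∈ S) :
    (γ.stopAt A).hitParam S = γ.hitParam S / γ.hitParam A := by
  set TA : ℝ := γ.hitParam A with hTA
  set TS : ℝ := γ.hitParam S with hTS
  have hSA : TS ≤ TA := hitParam_mono hAS γ
  have hTS0 : 0 ≤ TS := (γ.hitParam_mem_Icc S).1
  have hq : TS / TA ∈ Icc (0 : ℝ) 1 := ⟨div_nonneg hTS0 hpos.le, (div_le_one hpos).2 hSA⟩
  have hmemS : γ ⟨TS, γ.hitParam_mem_Icc S⟩ ∈ S := apply_hitParam_mem hS hmeet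
  refine le_antisymm ?_ ?_
  · -- the stopped curve is in `S` at parameter `TS / TA`
    refine hitParam_le (t := ⟨TS / TA, hq⟩) ?_
    rw [stopAt_apply]
    have h1 : TA * (TS / TA) = TS := mul_div_cancel₀ TS hpos.ne'
    have h2 : projIcc 0 1 zero_le_one (γ.hitParam A * ((⟨TS / TA, hq⟩ : I) : ℝ)) =
        ⟨TS, γ.hitParam_mem_Icc S⟩ := by
      rw [show γ.hitParam A * ((⟨TS / TA, hq⟩ : I) : ℝ) = TS from h1,
        projIcc_of_mem _ (γ.hitParam_mem_Icc S)]
    rw [h2]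
    exact hmemS
  · -- no earlier parameter of the stopped curve is in `S`
    refine le_csInf ⟨1, (γ.stopAt A).one_mem_hitSet S⟩ ?_
    rintro u (⟨hu, hmem⟩ | hu)
    · rw [stopAt_apply] at hmem
      have hTu : γ.hitParam A * u ∈ Icc (0 : ℝ) 1 :=
        ⟨mul_nonneg hpos.le hu.1,
          (mul_le_of_le_one_right hpos.le hu.2).trans (γ.hitParam_mem_Icc A).2⟩
      rw [projIcc_of_mem _ hTu] at hmem
      have hle : TS ≤ TA * u := hitParam_le hmem
      rw [div_le_iff₀ hpos]
      linarith [mul_comm TA u]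
    · rw [mem_singleton_iff.1 hu]
      exact hq.2

/-- **Stopping at a closed set `A` and then at a closed superset `S ⊇ A` is stopping at `S`**
(the curve meets `S` no later than `A`; as curves, not only modulo reparametrisation).
LSW (2001), §2 (stopping times `T ≤ T'`). [folklore] -/
theorem stopAt_stopAt_eq_stopAt {A S : Set E} (hA : IsClosed A) (hS : IsClosed S) (hAS : A ⊆ S)
    (γ : Curve E) : (γ.stopAt A).stopAt S = γ.stopAt S := by
  by_cases hmeet : ∃ t, γ t ∈ S
  swap
  · -- `S`, hence `A`, is never met: nothing is stopped
    push Not at hmeet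
    have hS1 : γ.hitParam S = 1 := hitParam_eq_one_of_forall_notMem hmeet
    have hA1 : γ.hitParam A = 1 := hitParam_eq_one_of_forall_notMem fun t h ↦ hmeet t (hAS h)
    rw [stopAt_eq_self_of_hitParam_eq_one hA1]
  rcases eq_or_lt_of_le (γ.hitParam_mem_Icc A).1 with h0 | hpos
  · -- the curve starts on `A ⊆ S`: everything is the constant curve at `γ 0`
    have hA0 : γ.hitParam A = 0 := h0.symm
    have hS0 : γ.hitParam S = 0 :=
      le_antisymm (by simpa using hitParam_le (t := (0 : I)) (hAS (apply_zero_mem_of_hitParam_eq_zero hA hA0)))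
        (γ.hitParam_mem_Icc S).1
    refine Curve.ext (ContinuousMap.ext fun s ↦ ?_)
    show ((γ.stopAt A).stopAt S) s = (γ.stopAt S) s
    rw [stopAt_apply, stopAt_apply_of_hitParam_eq_zero hA0, stopAt_apply_of_hitParam_eq_zero hS0]
  · have hq := hitParam_stopAt_of_subset hS hAS hpos hmeet
    set TA : ℝ := γ.hitParam A with hTA
    set TS : ℝ := γ.hitParam S with hTS
    have hSA : TS ≤ TA := hitParam_mono hAS γ
    have hTS0 : 0 ≤ TS := (γ.hitParam_mem_Icc S).1
    refine Curve.ext (ContinuousMap.ext fun s ↦ ?_)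
    show ((γ.stopAt A).stopAt S) s = (γ.stopAt S) s
    rw [stopAt_apply, stopAt_apply, stopAt_apply, hq]
    have hqs : TS / TA * s ∈ Icc (0 : ℝ) 1 :=
      ⟨mul_nonneg (div_nonneg hTS0 hpos.le) s.2.1,
        (mul_le_of_le_one_right (div_nonneg hTS0 hpos.le) s.2.2).trans ((div_le_one hpos).2 hSA)⟩
    rw [projIcc_of_mem _ hqs]
    congr 2
    show TA * (TS / TA * s) = TS * s
    rw [← mul_assoc, mul_div_cancel₀ TS hpos.ne']

end Topological

/-! ### Hitting parameters along shrinking stopping sets -/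

section Metric

variable {E : Type*} [MetricSpace E]

/-- **`hitParam (S n) γ → hitParam F γ` along closed stopping sets `S n ⊇ F` shrinking to the
closed set `F`** (every limit of points `z k ∈ S (φ k)` with `φ k → ∞` lies in `F`): the
hitting parameters are bounded by the one of `F`, and along a subsequence on which `S (φ k)` is
met they converge to a parameter at which the curve is in `F`. [folklore] -/
theorem tendsto_hitParam_of_shrinking {F : Set E} {S : ℕ → Set E} (hS : ∀ n, IsClosed (S n))
    (hFS : ∀ n, F ⊆ S n)
    (hlim : ∀ φ : ℕ → ℕ, Tendsto φ atTop atTop → ∀ z : ℕ → E, (∀ k, z k ∈ S (φ k)) →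
      ∀ x : E, Tendsto z atTop (𝓝 x) → x ∈ F)
    (γ : Curve E) :
    Tendsto (fun n : ℕ ↦ γ.hitParam (S n)) atTop (𝓝 (γ.hitParam F)) := by
  set t : ℕ → ℝ := fun n ↦ γ.hitParam (S n) with ht
  set T : ℝ := γ.hitParam F with hT
  have htT : ∀ n, t n ≤ T := fun n ↦ hitParam_mono (hFS n) γ
  have ht01 : ∀ n, t n ∈ Icc (0 : ℝ) 1 := fun n ↦ γ.hitParam_mem_Icc _
  refine tendsto_of_subseq_tendsto fun φ hφ ↦ ?_
  obtain ⟨tStar, htStar, ψ, hψ, hconv⟩ := isCompact_Icc.tendsto_subseq fun k ↦ ht01 (φ k)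
  refine ⟨ψ, ?_⟩
  -- it suffices to identify the subsequential limit `tStar` with `T`
  suffices hTeq : tStar = T by rw [← hTeq]; exact hconv
  have hle : tStar ≤ T := le_of_tendsto' hconv fun k ↦ htT _
  refine le_antisymm hle ?_
  by_cases hfreq : ∃ᶠ k in atTop, ∃ u, γ u ∈ S (φ (ψ k))
  · -- along a further subsequence the sets are met; the hitting points accumulate in `F`
    obtain ⟨χ, hχ, hmeet⟩ := extraction_of_frequently_atTop hfreq
    have hmem : ∀ k, γ ⟨t (φ (ψ (χ k))), ht01 _⟩ ∈ S (φ (ψ (χ k))) := fun k ↦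
      apply_hitParam_mem (hS _) (hmeet k)
    have hconv' : Tendsto (fun k ↦ t (φ (ψ (χ k)))) atTop (𝓝 tStar) :=
      hconv.comp hχ.tendsto_atTop
    have hI : Tendsto (fun k ↦ (⟨t (φ (ψ (χ k))), ht01 _⟩ : I)) atTop (𝓝 ⟨tStar, htStar⟩) := by
      rw [tendsto_subtype_rng]
      exact hconv'
    have hγ : Tendsto (fun k ↦ γ ⟨t (φ (ψ (χ k))), ht01 _⟩) atTop (𝓝 (γ ⟨tStar, htStar⟩)) :=
      (γ.continuous.tendsto _).comp hI
    have hF : γ ⟨tStar, htStar⟩ ∈ F :=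
      hlim (fun k ↦ φ (ψ (χ k))) ((hφ.comp hψ.tendsto_atTop).comp hχ.tendsto_atTop) _ hmem _ hγ
    exact hitParam_le hF
  · -- eventually the sets are not met: the hitting parameters are `1 ≥ T`
    have hev : ∀ᶠ k in atTop, t (φ (ψ k)) = 1 := by
      filter_upwards [not_frequently.1 hfreq] with k hk
      push Not at hk
      exact hitParam_eq_one_of_forall_notMem hk
    have h1 : tStar = 1 :=
      tendsto_nhds_unique hconv (tendsto_const_nhds.congr' (hev.mono fun k hk ↦ hk.symm))
    rw [h1]
    exact (γ.hitParam_mem_Icc F).2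

/-- **`stopAt (S n) γ → stopAt F γ`** along closed stopping sets shrinking to `F`
(reparametrisation metric). [folklore] -/
theorem tendsto_stopAt_of_shrinking {F : Set E} {S : ℕ → Set E} (hS : ∀ n, IsClosed (S n))
    (hFS : ∀ n, F ⊆ S n)
    (hlim : ∀ φ : ℕ → ℕ, Tendsto φ atTop atTop → ∀ z : ℕ → E, (∀ k, z k ∈ S (φ k)) →
      ∀ x : E, Tendsto z atTop (𝓝 x) → x ∈ F)
    (γ : Curve E) :
    Tendsto (fun n : ℕ ↦ γ.stopAt (S n)) atTop (𝓝 (γ.stopAt F)) := by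
  have hlim' := tendsto_hitParam_of_shrinking hS hFS hlim γ
  have hlimI : Tendsto (fun n : ℕ ↦ (⟨γ.hitParam (S n), γ.hitParam_mem_Icc _⟩ : I))
      atTop (𝓝 ⟨γ.hitParam F, γ.hitParam_mem_Icc F⟩) := by
    rw [tendsto_subtype_rng]; exact hlim'
  have h := tendsto_dist_comp_affineClamp γ hlimI (fun _ ↦ 0) (fun u ↦ u)
    (fun u v ↦ by simp) (fun u v ↦ le_rfl)
  rw [tendsto_iff_dist_tendsto_zero]
  refine h.congr fun n ↦ ?_
  rw [dist_comm]
  rfl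

end Metric

end Curve

namespace CurveClass

variable {E : Type*} [MetricSpace E]

/-- **Stopping a class at a closed set `A` and then at a closed superset `S ⊇ A` is stopping it
at `S`.** [folklore] -/
theorem stopAt_stopAt_eq_stopAt {A S : Set E} (hA : IsClosed A) (hS : IsClosed S) (hAS : A ⊆ S)
    (c : CurveClass E) : stopAt S (stopAt A c) = stopAt S c := by
  show stopAt S (mk (c.out.stopAt A)) = mk (c.out.stopAt S)
  rw [stopAt_mk_holds S hS, Curve.stopAt_stopAt_eq_stopAt hA hS hAS]

/-- **`stopAt (S n) c → stopAt F c`** for every curve class, along closed stopping sets shrinking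
to `F` (through the chosen representative; `mk` is continuous). [folklore] -/
theorem tendsto_stopAt_of_shrinking {F : Set E} {S : ℕ → Set E} (hS : ∀ n, IsClosed (S n))
    (hFS : ∀ n, F ⊆ S n)
    (hlim : ∀ φ : ℕ → ℕ, Tendsto φ atTop atTop → ∀ z : ℕ → E, (∀ k, z k ∈ S (φ k)) →
      ∀ x : E, Tendsto z atTop (𝓝 x) → x ∈ F)
    (c : CurveClass E) :
    Tendsto (fun n : ℕ ↦ stopAt (S n) c) atTop (𝓝 (stopAt F c)) :=
  (continuous_mk.tendsto _).comp (Curve.tendsto_stopAt_of_shrinking hS hFS hlim c.out)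

end CurveClass

/-! ### Transfer of stopped laws to a larger stopping set, and to the limit -/

/-- **A common `A`-stopped law gives a common `S`-stopped law for every closed `S ⊇ A`**
(`stopAt S = stopAt S ∘ stopAt A` and `stopAt S` is Borel). [folklore] -/
theorem measure_preimage_stopAt_eq_of_subset {μ ν : Measure (CurveClass ℂ)} {A S : Set ℂ}
    (hA : IsClosed A) (hS : IsClosed S) (hAS : A ⊆ S)
    (h : ∀ T : Set (CurveClass ℂ), MeasurableSet T →
      μ (CurveClass.stopAt A ⁻¹' T) = ν (CurveClass.stopAt A ⁻¹' T))
    {T : Set (CurveClass ℂ)} (hT : MeasurableSet T) :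
    μ (CurveClass.stopAt S ⁻¹' T) = ν (CurveClass.stopAt S ⁻¹' T) := by
  have hset : CurveClass.stopAt S ⁻¹' T =
      CurveClass.stopAt A ⁻¹' (CurveClass.stopAt S ⁻¹' T) := by
    ext c
    simp only [mem_preimage, CurveClass.stopAt_stopAt_eq_stopAt hA hS hAS]
  rw [hset]
  exact h _ ((CurveClass.measurable_stopAt hS) hT)

/-- **Stopped laws pass to the limit along shrinking stopping sets** (push-forward form): if two
finite Borel measures on planar curve classes have the same push-forward under `stopAt (S n)`
for every `n`, where the closed sets `S n ⊇ F` shrink to the closed set `F`, they have the same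
push-forward under `stopAt F` (dominated convergence on bounded continuous test functions).
[folklore] -/
theorem Measure.map_stopAt_eq_of_shrinking {μ ν : Measure (CurveClass ℂ)} [IsFiniteMeasure μ]
    [IsFiniteMeasure ν] {F : Set ℂ} {S : ℕ → Set ℂ} (hF : IsClosed F) (hS : ∀ n, IsClosed (S n))
    (hFS : ∀ n, F ⊆ S n)
    (hlim : ∀ φ : ℕ → ℕ, Tendsto φ atTop atTop → ∀ z : ℕ → ℂ, (∀ k, z k ∈ S (φ k)) →
      ∀ x : ℂ, Tendsto z atTop (𝓝 x) → x ∈ F)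
    (h : ∀ n : ℕ, μ.map (CurveClass.stopAt (S n)) = ν.map (CurveClass.stopAt (S n))) :
    μ.map (CurveClass.stopAt F) = ν.map (CurveClass.stopAt F) := by
  have hm : Measurable (CurveClass.stopAt F : CurveClass ℂ → CurveClass ℂ) :=
    CurveClass.measurable_stopAt hF
  have hmn : ∀ n : ℕ, Measurable (CurveClass.stopAt (S n) : CurveClass ℂ → CurveClass ℂ) :=
    fun n ↦ CurveClass.measurable_stopAt (hS n)
  haveI : IsFiniteMeasure (μ.map (CurveClass.stopAt F)) := Measure.isFiniteMeasure_map μ _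
  refine ext_of_forall_lintegral_eq_of_IsFiniteMeasure fun g ↦ ?_
  have key : ∀ (ρ : Measure (CurveClass ℂ)) [IsFiniteMeasure ρ],
      Tendsto (fun n : ℕ ↦ ∫⁻ c, g c ∂(ρ.map (CurveClass.stopAt (S n))))
        atTop (𝓝 (∫⁻ c, g c ∂(ρ.map (CurveClass.stopAt F)))) := by
    intro ρ _
    simp_rw [lintegral_map g.continuous.measurable.coe_nnreal_ennreal (hmn _),
      lintegral_map g.continuous.measurable.coe_nnreal_ennreal hm]
    refine tendsto_lintegral_of_dominated_convergence (fun _ ↦ (nndist g 0 : ℝ≥0∞))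
      (fun n ↦ (g.continuous.measurable.coe_nnreal_ennreal.comp (hmn n)))
      (fun n ↦ Eventually.of_forall fun c ↦ ?_) ?_ (Eventually.of_forall fun c ↦ ?_)
    · exact ENNReal.coe_le_coe.2 (BoundedContinuousFunction.NNReal.upper_bound g _)
    · rw [lintegral_const]; exact ENNReal.mul_ne_top ENNReal.coe_ne_top (measure_ne_top _ _)
    · exact ((ENNReal.continuous_coe.comp g.continuous).tendsto _).comp
        (CurveClass.tendsto_stopAt_of_shrinking hS hFS hlim c)
  have h1 := key μ
  have h2 := key ν
  simp_rw [h] at h1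
  exact tendsto_nhds_unique h1 h2

/-- **Preimage form**: if `μ (stopAt (S n) ⁻¹' T) = ν (stopAt (S n) ⁻¹' T)` for all `n` and all
Borel `T`, where the closed sets `S n ⊇ F` shrink to the closed set `F`, then
`μ (stopAt F ⁻¹' T) = ν (stopAt F ⁻¹' T)` for all Borel `T`. [folklore] -/
theorem measure_preimage_stopAt_eq_of_shrinking {μ ν : Measure (CurveClass ℂ)} [IsFiniteMeasure μ]
    [IsFiniteMeasure ν] {F : Set ℂ} {S : ℕ → Set ℂ} (hF : IsClosed F) (hS : ∀ n, IsClosed (S n))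
    (hFS : ∀ n, F ⊆ S n)
    (hlim : ∀ φ : ℕ → ℕ, Tendsto φ atTop atTop → ∀ z : ℕ → ℂ, (∀ k, z k ∈ S (φ k)) →
      ∀ x : ℂ, Tendsto z atTop (𝓝 x) → x ∈ F)
    (h : ∀ n : ℕ, ∀ T : Set (CurveClass ℂ), MeasurableSet T →
      μ (CurveClass.stopAt (S n) ⁻¹' T) = ν (CurveClass.stopAt (S n) ⁻¹' T))
    {T : Set (CurveClass ℂ)} (hT : MeasurableSet T) :
    μ (CurveClass.stopAt F ⁻¹' T) = ν (CurveClass.stopAt F ⁻¹' T) := by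
  have hm : Measurable (CurveClass.stopAt F : CurveClass ℂ → CurveClass ℂ) :=
    CurveClass.measurable_stopAt hF
  have hmn : ∀ n : ℕ, Measurable (CurveClass.stopAt (S n) : CurveClass ℂ → CurveClass ℂ) :=
    fun n ↦ CurveClass.measurable_stopAt (hS n)
  have hmap : ∀ n : ℕ, μ.map (CurveClass.stopAt (S n)) = ν.map (CurveClass.stopAt (S n)) :=
    fun n ↦ Measure.ext fun T hT ↦ by
      rw [Measure.map_apply (hmn n) hT, Measure.map_apply (hmn n) hT]; exact h n T hT
  have := Measure.map_stopAt_eq_of_shrinking hF hS hFS hlim hmap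
  have h' := congrArg (fun ρ : Measure (CurveClass ℂ) ↦ ρ T) this
  simpa only [Measure.map_apply hm hT] using h'

end Literature.Probability.RandomPlanarGeometry

end
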